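import Summits.BirchSwinnertonDyer.BirchSwinnertonDyer.Theorems.SmallImageMuTransferMuTransferOfZetaSideAnyImage
import Summits.BirchSwinnertonDyer.BirchSwinnertonDyer.Theorems.ByReductionTypeAtTwoSelmerDualInvolutionTwist
import Literature.NumberTheory.EllipticCurves.Kato2004.DivisibilityInputsContragredient
import Literature.NumberTheory.EllipticCurves.IwasawaAlgebraInvolutionFixedPrimesProofs
import HarnessLib

/-!
# The crux `MuTransfer` (stmt-BirchSwinnertonDyer-19629) BY NAME modulo the PRINT-EXACT contragredient twin
# F1ᶜ = `Kato2004.exists_divisibilityInputs_fineQuotient_zeta_contra` of Kato's §17.13 package — the ARM-P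
# «stronger-than-print-by-ι» flag on F1 / ZS removed from the crux's published-input surface

Cell `bsd-smallim` (rung K6 of `BirchSwinnertonDyer`, class X9), seat `bsd-line-k6-p2` gen 4 (D-0154 KEY (146) row 9;
line `f1_fine` of `Cruxes/MuTransfer`).  HONEST FRAMING: THEOREMS ONLY (no definition, no named fact, no instance, no
`sorry`); proves no case of BSD and closes no item — 19629 stays OPEN by design; the deciding theorems here are
CONDITIONAL on ONE named published CONSTRUCTION fact (the gate records `conditional-result`).  PARTITION (D-0054):
X9 (A4) and the surjective good-ordinary rows — types-the-object-of; closes NONE.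

## Why this file

Of record (this seat, gens 0–3): the crux is kernel-checked modulo F1 = `Kato2004.exists_divisibilityInputs_fineQuotient_zeta`
(`Theorems.smallImageMuTransfer_MuTransfer_of_fine`, p482919) and modulo its zeta side ZS = `Kato2004.exists_zetaSideInputs`
(`Theorems.smallImageMuTransfer_MuTransfer_of_zetaSide`, p610284).  BOTH facts bind Kato's (17.13.1) maps
`P → X(E/ℚ_∞) → X₀(E/ℚ_∞)` as `Λ`-LINEAR maps into the tree's γ-keyed duals `D : W.SelmerDualData κ γ`,
`Y : W.FineSelmerDualData κ γ` (`T` acting by PRE-composition with `conj_γ`) against the covariant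
`I : Kato2004.IwasawaH1Data W p κ γ` (`1 + T ↦ conj_γ`).  Cell `bsd-cited`'s ARM-P audit (r02 ADDENDUM-8, RULING (650),
R-48, flag `Kato-1713-dual-action`) classified every such package STRONGER-THAN-PRINT-BY-ι: Poitou–Tate duality
intertwines the covariant action on `𝐇¹_loc` with the CONTRAGREDIENT action `x ↦ x ∘ conj_{γ⁻¹}` on the Pontryagin
dual, so the printed `Λ`-linear (17.13.1) is the package with `D : W.SelmerDualData κ γ⁻¹`, `Y : W.FineSelmerDualData κ γ⁻¹`
— the print-exact twin F1ᶜ = `Kato2004.exists_divisibilityInputs_fineQuotient_zeta_contra` (file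
`Kato2004/DivisibilityInputsContragredient`, p604443) — and the END roads are to be re-keyed by their owners with the
twist lemma T-TWIST-SEL-1 (`SignedKatoOffTwo.IwasawaInvolution.exists_twist_selmerDualData_invol`, p609264).  THIS FILE is
that re-key for the μ-road of crux 19629 (owner: this seat), after the model of cell `bsd-stepL`'s multiplicative re-key
`X11b.MultMu.mu_eq_zero_of_multFineContra`:

* §1 `smallImageMuTransfer_exists_isEulerSystemClass_notMem_of_contra`, `smallImageMuTransfer_lengthAt_X_le_of_contra` —
  the two module-algebra steps of the μ-bookkeeping (§6 (i) of the cell's μ-transfer; (14.9.3)/(17.13.1) at a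
  height-one prime) for `Kato2004.DivisibilityInputsContra` (proofs token-for-token those over `ZetaSideInputs`).
* §2 **`smallImageMuTransfer_mu_eq_zero_of_irr_of_fineZetaContra`** — SAME conclusion as gen 2's
  `smallImageMuTransfer_mu_eq_zero_of_irr_of_zetaSide` (`D.mu = 0` for EVERY γ-keyed cyclotomic dual Selmer datum `D`,
  at every ODD good ordinary `p` with `E[p]` irreducible, ANY image, one unit coefficient of `L_p(f, α)`), from F1ᶜ:
  twist `D ↦ D′ : W.SelmerDualData κ γ⁻¹` and a fine dual `Y ↦ Y′` (`exists_twist_{selmer,fineSelmer}DualData_invol`,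
  `Λ`-finiteness transported), apply F1ᶜ to `(𝐇¹_γ, D′, Y′)`, run gen 2's argument verbatim (GV Prop. 3.7 ⟹ `ι G₁ = L_p`,
  certificate ⟹ `G₁ ∉ (p)`; p. 280 at `(p)` + Thm. 12.6 span ⟹ a GENUINE Euler-system class `∉ p𝐇¹`; the image-facts
  core `CoreAssembly.coreIrr_anyReduction_holds` (γ-keyed, unconditional) ⟹ `Sel₀(ℚ_∞, E[p^∞])[p]` killed by `T^J` ⟹
  `Y′.X/(p)` finite — key-free ⟹ `length_(p) Y′.X = 0` ⟹ `length_(p) D′.X = 0`), and come back by the twist's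
  length clause at the ι-FIXED prime `(p)` (`IwasawaAlgebra.comap_invol_eq_self_of_asIdeal_eq_augIdealP`).  No
  functional equation of `L_p` is needed on the μ-road (μ is ι-invariant).
* §3 **`smallImageMuTransfer_MuTransfer_of_fineZetaContra : F1ᶜ → Theses.SmallImageMuTransfer.MuTransfer`** — the crux BY
  NAME modulo the print-exact package alone (and the `Rank1Residual.KatoMuTransfer` spelling).

So the published-input surface of the WHOLE crux is now a package that print supplies as stated (per ARM-P), at the
price of re-admitting the fields of F1ᶜ that the μ-road does not touch (`H2`, `δ`, `ε`, `es_bound`, `integral`, …; a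
zeta-side contragredient sub-package `ZetaSideInputsContra` would be the true-size statement — Literature typing, not
done here).  CONDITIONAL on F1ᶜ; nothing asserted about any curve; BSD is not advanced.
Credit: defn-ty1 g18 (F1ᶜ, p604443), bsd-2adic tower-1 g19 (T-TWIST-SEL-1), bsd-wall tp2-p2x (involution algebra,
fine twist), b2b (ι-fixed primes), bsd-stepL corner-p1 g16 (the multiplicative model), bsd-potss k9-c4 (the core),
ARM-P r02 / lead (the audit).

References (locators only): K. Kato, Astérisque 295 (2004) Thm. 12.5 (1), 12.6, Ex. 13.3, §13.8, (14.9.3), Thm. 16.6 (2),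
§17.3, 17.5, Prop. 17.11, §17.13 [Kato2004Asterisque]; R. Greenberg, V. Vatsal, Invent. Math. 142 (2000) Prop. 3.7
[GreenbergVatsal2000]; R. Greenberg, Adv. Stud. Pure Math. 17 (1989) pp. 101–102 (`S^ι`) [Greenberg1989];
L. Washington, *Introduction to Cyclotomic Fields*, §13.2 [Washington1997]; R. Greenberg, LNM 1716, §1 Conj. 1.11 (shape)
[GreenbergLNM1716].
-/

-- the summit and its single problem are both named `BirchSwinnertonDyer` (registry layout D-0017)
set_option linter.dupNamespace false
set_option autoImplicit false

noncomputable section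

open scoped Classical MatrixGroups ModularForm NumberField
open CongruenceSubgroup WeierstrassCurve Field IsDedekindDomain
open Literature.NumberTheory.GaloisRepresentations
open Literature.NumberTheory.EllipticCurves Literature.NumberTheory.EllipticCurves.ModularForms
open Literature.NumberTheory.EllipticCurves.Kato2004
open Literature.NumberTheory.EllipticCurves.Kato2004.EulerSystemValues
open Literature.NumberTheory.EllipticCurves.Rank1Residual
open Summit.BirchSwinnertonDyer.BirchSwinnertonDyer.Rank1Residual
open Summit.BirchSwinnertonDyer.BirchSwinnertonDyer.Theses.SmallImageMuTransfer

namespace Summit.BirchSwinnertonDyer.BirchSwinnertonDyer.Theorems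

open Module

/-! ## §1 Module algebra over a CONTRAGREDIENT §17.13 package (ports of the `ZetaSideInputs` bookkeeping) -/

section Algebra

variable {p : ℕ} [Fact p.Prime] {W : WeierstrassCurve ℚ} [W.IsElliptic] [W.IsGloballyMinimal]
  [ContinuousSMul ℤ_[p] (W.tateModule p)] [Module.Free ℤ_[p] (W.tateModule p)]
  [Module.Finite ℤ_[p] (W.tateModule p)] {N : ℕ} [NeZero N] {f : CuspForm (Gamma0 N) 2}
  {κ : ZpExtension ℚ p} {γ : absoluteGaloisGroup ℚ}
  {I : IwasawaH1Data W p κ γ} {D' : W.SelmerDualData κ γ⁻¹}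

omit [NeZero N] in
/-- **§6 (i) with Thm. 12.6 / Ex. 13.3 for a CONTRAGREDIENT §17.13 package**: if `G₁ ∉ (p)` and some `s ∉ (p)` has
`s·G₁ ∈ col(loc Z)`, and `Z` lies in the `Λ`-span of GENUINE `Λ`-adic Euler-system classes, then some genuine
Euler-system class is NOT in `p·𝐇¹_Γ(T_pW)` (were `Z ⊆ p𝐇¹`, then `col(loc Z) ⊆ pΛ ∋ s·G₁` with `(p)` prime).
(`ZetaSideInputs.exists_isEulerSystemClass_notMem`, token-for-token, for `Kato2004.DivisibilityInputsContra`.)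
[cite: Kato2004Asterisque, Thm. 12.6 (p. 222), Ex. 13.3 (p. 225) and §17.13 (p. 280)] -/
theorem smallImageMuTransfer_exists_isEulerSystemClass_notMem_of_contra (K : DivisibilityInputsContra W p f κ γ I D')
    (hZ : K.Z ≤ Submodule.span (IwasawaAlgebra p) {s : I.H | IsEulerSystemClass W p κ γ I s})
    {G₁ : IwasawaAlgebra p} (hμ : G₁ ∉ IwasawaAlgebra.augIdealP p)
    (himg : ∃ s : IwasawaAlgebra p, s ∉ IwasawaAlgebra.augIdealP p ∧
      s * G₁ ∈ Submodule.map (K.col ∘ₗ K.loc) K.Z) :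
    ∃ s : I.H, IsEulerSystemClass W p κ γ I s ∧
      s ∉ IwasawaAlgebra.augIdealP p • (⊤ : Submodule (IwasawaAlgebra p) I.H) := by
  obtain ⟨s, hs, hsG⟩ := himg
  suffices hz : ∃ z ∈ K.Z, z ∉ IwasawaAlgebra.augIdealP p • (⊤ : Submodule (IwasawaAlgebra p) I.H) by
    obtain ⟨z, hz, hzp⟩ := hz
    obtain ⟨t, ht, htp⟩ := exists_mem_not_mem_of_le_span hZ hz hzp
    exact ⟨t, ht, htp⟩
  by_contra hcon
  push Not at hcon
  have hZp : K.Z ≤ IwasawaAlgebra.augIdealP p • (⊤ : Submodule (IwasawaAlgebra p) I.H) :=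
    fun z hz ↦ hcon z hz
  have hsub : Submodule.map (K.col ∘ₗ K.loc) K.Z ≤
      (IwasawaAlgebra.augIdealP p • ⊤ : Submodule (IwasawaAlgebra p) (IwasawaAlgebra p)) :=
    (Submodule.map_mono hZp).trans (by rw [Submodule.map_smul'']; exact Submodule.smul_mono le_rfl le_top)
  have htop : (IwasawaAlgebra.augIdealP p • ⊤ : Submodule (IwasawaAlgebra p) (IwasawaAlgebra p)) =
      IwasawaAlgebra.augIdealP p := by
    rw [Ideal.smul_eq_mul, Ideal.mul_top]
  have hsG' : s * G₁ ∈ IwasawaAlgebra.augIdealP p := by rw [← htop]; exact hsub hsG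
  rcases (IwasawaAlgebra.isPrime_augIdealP_holds p).mem_or_mem hsG' with h | h
  · exact hs h
  · exact hμ h

omit [Module.Free ℤ_[p] (W.tateModule p)] [Module.Finite ℤ_[p] (W.tateModule p)] [NeZero N] in
/-- **(14.9.3)/(17.13.1) bookkeeping at a height-one prime `𝔭` for a CONTRAGREDIENT §17.13 package**: `loc ; toX` exact
at `P`, `col : P ↪ Λ`, `s·G₁ ∈ col(loc Z)` with `s, G₁ ∉ 𝔭`, and `π : X → Y` exact after `P → X` give
`length X_𝔭 ≤ length Y_𝔭` — `(Λ/col(loc Z))_𝔭 = 0`, `P/loc Z ↪ Λ/col(loc Z)`, `P/loc Z → X → Y` exact at `X`.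
(`ZetaSideInputs.lengthAt_X_le_lengthAt_fine`, token-for-token, for `Kato2004.DivisibilityInputsContra`.)
[cite: Kato2004Asterisque, (14.9.3) (p. 240), Prop. 17.11 (p. 277) and §17.13 (pp. 279–280)] -/
theorem smallImageMuTransfer_lengthAt_X_le_of_contra (K : DivisibilityInputsContra W p f κ γ I D')
    {G₁ : IwasawaAlgebra p} (𝔭 : PrimeSpectrum (IwasawaAlgebra p)) (hG𝔭 : G₁ ∉ 𝔭.asIdeal)
    (himg : ∃ s : IwasawaAlgebra p, s ∉ 𝔭.asIdeal ∧ s * G₁ ∈ Submodule.map (K.col ∘ₗ K.loc) K.Z)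
    {Y : Type*} [AddCommGroup Y] [Module (IwasawaAlgebra p) Y]
    (π : D'.X →ₗ[IwasawaAlgebra p] Y) (hπ : Function.Exact K.toX π) :
    lengthAt (IwasawaAlgebra p) D'.X 𝔭 ≤ lengthAt (IwasawaAlgebra p) Y 𝔭 := by
  obtain ⟨s, hs, hsG⟩ := himg
  set LZ : Submodule (IwasawaAlgebra p) K.P := Submodule.map K.loc K.Z with hLZ
  set M : Ideal (IwasawaAlgebra p) := Submodule.map K.col LZ with hM
  have hM_eq : Submodule.map (K.col ∘ₗ K.loc) K.Z = M := by
    rw [hM, hLZ, Submodule.map_comp]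
  have hsGM : s * G₁ ∈ M := hM_eq ▸ hsG
  have hnot : ¬ M ≤ 𝔭.asIdeal := fun hle ↦ by
    rcases 𝔭.isPrime.mem_or_mem (hle hsGM) with h | h
    · exact hs h
    · exact hG𝔭 h
  have hΛM : lengthAt (IwasawaAlgebra p) (IwasawaAlgebra p ⧸ M) 𝔭 = 0 :=
    lengthAt_quotient_eq_zero_of_not_le hnot
  have hPLZ : lengthAt (IwasawaAlgebra p) (K.P ⧸ LZ) 𝔭 = 0 := by
    refine le_antisymm ?_ bot_le
    rw [← hΛM]
    refine lengthAt_le_of_injective (Submodule.mapQ LZ M K.col fun y hy ↦ ⟨y, hy, rfl⟩) ?_ 𝔭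
    rw [← LinearMap.ker_eq_bot, Submodule.ker_mapQ, hM,
      Submodule.comap_map_eq_of_injective K.col_injective, Submodule.mkQ_map_self]
  have hle : LZ ≤ LinearMap.ker K.toX := by
    rintro _ ⟨z, -, rfl⟩
    exact (K.exact_P (K.loc z)).mpr ⟨z, rfl⟩
  let f' : (K.P ⧸ LZ) →ₗ[IwasawaAlgebra p] D'.X := LZ.liftQ K.toX hle
  have hf' : Function.Exact f' π := by
    rw [LinearMap.exact_iff, Submodule.range_liftQ]
    exact LinearMap.exact_iff.mp hπ
  calc lengthAt (IwasawaAlgebra p) D'.X 𝔭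
      ≤ lengthAt (IwasawaAlgebra p) (K.P ⧸ LZ) 𝔭 + lengthAt (IwasawaAlgebra p) Y 𝔭 :=
        lengthAt_le_add_of_exact f' π hf' 𝔭
    _ = lengthAt (IwasawaAlgebra p) Y 𝔭 := by rw [hPLZ, zero_add]

end Algebra

/-! ## §2 `μ = 0` at every odd good ordinary prime with `E[p]` irreducible — ANY image — from the print-exact F1ᶜ -/

/-- **`μ(X(E/ℚ_∞)) = 0` at every ODD good ordinary prime with `E[p]` irreducible — `ρ̄_{E,p}` onto or not, CM or not —
given one unit coefficient of `L_p(f, α)`, modulo the PRINT-EXACT contragredient §17.13 package F1ᶜ ALONE**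
(`Kato2004.exists_divisibilityInputs_fineQuotient_zeta_contra`).  The statement of gen 2's
`smallImageMuTransfer_mu_eq_zero_of_irr_of_zetaSide` VERBATIM (conclusion `D.mu = 0` for every γ-keyed datum `D`), with
the input re-keyed ZS ↦ F1ᶜ.  Proof: twist `D` and a fine dual `Y` to the contragredient `Λ`-structure
(`exists_twist_selmerDualData_invol_of_mul_inv`, `exists_twist_fineSelmerDualData_invol`; `Λ`-finiteness transported),
apply F1ᶜ to `(𝐇¹_γ, D′, Y′)`; GV Prop. 3.7 gives `ι G₁ = L_p` and the certificate `G₁ ∉ (p)`; p. 280 read at the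
height-one prime `(p)` and the Thm. 12.6 span clause give a GENUINE Euler-system class outside `p𝐇¹` (§1); the image-facts
core `CoreAssembly.coreIrr_anyReduction_holds` ((SC)/(IF) at every irreducible `E[p]`, `p` odd — gen 2 §2) kills
`Sel₀(ℚ_∞, E[p^∞])[p]` by a power of `T`, so `Y′.X/(p)` is finite and `length_(p) Y′.X = 0`; §1 gives
`length_(p) D′.X = 0`; `(p)` is ι-fixed, so `length_(p) D.X = length_(p) D′.X = 0`, i.e. `D.mu = 0`.  Conditional on F1ᶜ
only; nothing asserted.
[cite: Kato2004Asterisque, Thm. 12.6 (p. 222), Ex. 13.3 (p. 225), §13.8 (pp. 228–229), (14.9.3) (p. 240), Thm. 16.6 (2) (p. 271), §17.3 (p. 273), Prop. 17.11 (p. 277) and §17.13 (pp. 279–280)]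
[cite: GreenbergVatsal2000, Prop. 3.7] [cite: Greenberg1989, §0 pp. 101–102 (S^ι)] [cite: Washington1997, §13.2] -/
theorem smallImageMuTransfer_mu_eq_zero_of_irr_of_fineZetaContra
    (hF1c : exists_divisibilityInputs_fineQuotient_zeta_contra) :
    ∀ (W : WeierstrassCurve ℚ) [W.IsElliptic] [W.IsGloballyMinimal] (p : ℕ) [Fact p.Prime]
      {N : ℕ} [NeZero N] (f : CuspForm (Gamma0 N) 2),
      p ≠ 2 → W.HasGoodReductionAtPrime p → ¬ (p : ℤ) ∣ W.frobeniusTrace p →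
      W.HasIrreducibleModPGaloisRep p → IsNewformOf W f →
      (∃ n : ℕ, ‖PowerSeries.coeff n (padicLFunction f (unitRoot W p : ℚ_[p]))‖ = 1) →
      ∀ (κ : ZpExtension ℚ p) (γ : absoluteGaloisGroup ℚ),
        κ.IsCyclotomic → κ.IsTopGenerator γ → IsCyclotomicVariable p γ →
        ∀ D : W.SelmerDualData κ γ, D.mu = 0 := by
  intro W _ _ p _ N _ f hp2 hgood hap hirr hf hcert κ γ hκ hγ hγ' D
  haveI : ContinuousSMul ℤ_[p] (W.tateModule p) := TateModule.continuousSMul_padicInt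
  haveI : Module.Free ℤ_[p] (W.tateModule p) := W.module_free_tateModule_holds p
  haveI : Module.Finite ℤ_[p] (W.tateModule p) := W.module_finite_tateModule_holds p
  have hord : IsOrdinaryAt W p := ⟨hgood, hap⟩
  -- the image facts (SC)/(IF), onto or not (gen 2 §2)
  have hSC := exists_smul_eq_val_smul_of_irreducible_of_ne_two W p hp2 hirr
  have hIF := forall_normal_index_ne_of_irreducible_of_ne_two W p hp2 hirr
  -- the pinned modules: `𝐇¹_Γ(T_pW)` (γ-keyed) and a dual fine Selmer datum (γ-keyed)
  obtain ⟨I⟩ := nonempty_iwasawaH1Data_holds W p κ γ hκ hγ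
  obtain ⟨Y⟩ := W.nonempty_fineSelmerDualData κ hγ
  -- `X(E/ℚ_∞)` is finitely generated over `Λ` for the cyclotomic `κ` (tree theorem, NORMALISED generator)
  haveI : Module.Finite (IwasawaAlgebra p) D.X :=
    WeierstrassCurve.SelmerDualData.module_finite_of_isCyclotomic W κ hκ D hγ
  -- TWIST both duals to the CONTRAGREDIENT `Λ`-structure (`T ↦ (1+T)⁻¹ − 1`, i.e. `γ ↦ γ⁻¹`)
  obtain ⟨D', eD, heD, -, -, -, hlenD, hfinD⟩ :=
    SignedKatoOffTwo.IwasawaInvolution.exists_twist_selmerDualData_invol_of_mul_inv D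
  obtain ⟨Y', eY, heY, -, -, -, -⟩ :=
    SignedKatoOffTwo.IwasawaInvolution.exists_twist_fineSelmerDualData_invol (mul_inv_cancel γ) Y
  haveI : Module.Finite (IwasawaAlgebra p) D'.X := hfinD.mp inferInstance
  -- Kato's PRINT-EXACT §17.13 package for `(𝐇¹_γ, D′, Y′)`, with fine quotient and span clause
  obtain ⟨K, π, hπs, hπ, hZ⟩ := hF1c W p f κ γ hp2 hord hκ hγ hγ' hf I D' Y'
  haveI : Module.Finite (IwasawaAlgebra p) Y'.X := Module.Finite.of_surjective π hπs
  -- `L_p ∈ Λ` (GV Prop. 3.7) and the certificate: `G₁ ∉ (p)`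
  obtain ⟨G₁, hG₁⟩ := exists_iwasawaToPowerSeries_eq_padicLFunction hp2 hord hf hirr
  have hμL : G₁ ∉ IwasawaAlgebra.augIdealP p := not_mem_augIdealP_of_norm_coeff_eq_one hG₁ hcert
  let 𝔭 : PrimeSpectrum (IwasawaAlgebra p) :=
    ⟨IwasawaAlgebra.augIdealP p, IwasawaAlgebra.isPrime_augIdealP_holds p⟩
  -- p. 280 read at the height-one prime `(p)`: `s ∉ (p)`, `s·G₁ ∈ col(loc Z)`
  have himg𝔭 : ∃ s : IwasawaAlgebra p, s ∉ IwasawaAlgebra.augIdealP p ∧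
      s * G₁ ∈ Submodule.map (K.col ∘ₗ K.loc) K.Z := by
    obtain ⟨s, hs, hsG, -⟩ :=
      K.image_zeta_localized hirr G₁ hG₁ 𝔭 (by exact IwasawaAlgebra.height_augIdealP_holds p)
    exact ⟨s, hs, hsG⟩
  -- §6 (i) with the span clause: some GENUINE Euler-system class is not divisible by `p`
  obtain ⟨s, hs, hsp⟩ := smallImageMuTransfer_exists_isEulerSystemClass_notMem_of_contra K hZ hμL himg𝔭
  -- the core under image facts (cell bsd-potss, unconditional, any reduction, odd prime; γ-keyed)
  obtain ⟨J, hJ⟩ := CoreAssembly.coreIrr_anyReduction_holds W p κ γ I hp2 hirr hSC hIF hκ hγ ⟨s, hs, hsp⟩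
  -- `Sel₀[p]` finite ⟹ `Y′.X/(p)` finite — key-free
  haveI : Finite (Y'.X ⧸ (IwasawaAlgebra.augIdealP p • (⊤ : Submodule (IwasawaAlgebra p) Y'.X))) :=
    Y'.finite_quotient_augIdealP_of_finite_pTorsion
      (W.finite_fineSelmerInfty_pTorsion_of_forall_iterate_eq_zero κ hγ hJ)
  -- bookkeeping at `𝔭 = (p)`: `length Y′_𝔭 = 0 ⟹ length D′_𝔭 = 0`
  have hY0 : Module.lengthAt (IwasawaAlgebra p) Y'.X 𝔭 = 0 :=
    Summit.BirchSwinnertonDyer.BirchSwinnertonDyer.Rank1Residual.KatoMuSkeleton.lengthAt_eq_zero_of_finite_quotient_p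
      (M := Y'.X) 𝔭 rfl
  have hX0' : Module.lengthAt (IwasawaAlgebra p) D'.X 𝔭 = 0 :=
    le_antisymm ((smallImageMuTransfer_lengthAt_X_le_of_contra K 𝔭 hμL himg𝔭 π hπ).trans hY0.le) bot_le
  -- back to the γ-datum: `(p)` is a fixed point of `ι` on `Spec Λ`
  have hX0 : Module.lengthAt (IwasawaAlgebra p) D.X 𝔭 = 0 := by
    rw [← IwasawaAlgebra.comap_invol_eq_self_of_asIdeal_eq_augIdealP p 𝔭 rfl, hlenD 𝔭]
    exact hX0'
  change muInvariant p D.X = 0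
  rw [muInvariant_eq_toNat_lengthAt p D.X 𝔭 rfl, hX0]
  rfl

/-! ## §3 The parent item by name, modulo the print-exact package ALONE -/

/-- **The parent crux `MuTransfer` (stmt-BirchSwinnertonDyer-19629), literally the route decl, modulo the PRINT-EXACT
contragredient §17.13 package F1ᶜ ALONE** (`Kato2004.exists_divisibilityInputs_fineQuotient_zeta_contra`: Kato's package on
`(𝐇¹_Γ(T_pW), X(E/ℚ_∞), X₀(E/ℚ_∞))` with both duals in their contragredient `Λ`-structure — the one for which (17.13.1) is
`Λ`-linear as printed, ARM-P R-48).  `smallImageMuTransfer_mu_eq_zero_of_irr_of_fineZetaContra` at `5 ≤ p`.  Conditional;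
the item stays open until F1ᶜ (or a print-exact sub-package of it) is a theorem; BSD not advanced.
[cite: Kato2004Asterisque, Thm. 12.6 (p. 222), (14.9.3) (p. 240), §17.3 (p. 273), Prop. 17.11 (p. 277) and §17.13 (pp. 279–280)]
[cite: GreenbergVatsal2000, Prop. 3.7] [cite: Greenberg1989, §0 pp. 101–102 (S^ι)] -/
theorem smallImageMuTransfer_MuTransfer_of_fineZetaContra
    (hF1c : exists_divisibilityInputs_fineQuotient_zeta_contra) :
    Summit.BirchSwinnertonDyer.BirchSwinnertonDyer.Theses.SmallImageMuTransfer.MuTransfer := by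
  unfold Summit.BirchSwinnertonDyer.BirchSwinnertonDyer.Theses.SmallImageMuTransfer.MuTransfer
    Summit.BirchSwinnertonDyer.BirchSwinnertonDyer.Rank1Residual.KatoMuTransfer
  intro W _ _ p _ N _ f hp hgood hap hirr hf hcert κ γ hκ hγ hγ' D
  exact smallImageMuTransfer_mu_eq_zero_of_irr_of_fineZetaContra hF1c W p f (by omega) hgood hap hirr hf hcert
    κ γ hκ hγ hγ' D

/-- **The same statement under the tree's name `Rank1Residual.KatoMuTransfer`** (head constant of item 19629 and of
`Theses.PrintX9.MuTransfer`), modulo the print-exact F1ᶜ alone.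
[cite: Kato2004Asterisque, §17.3 (p. 273) and §17.13 (pp. 279–280)] [cite: Greenberg1989, §0 pp. 101–102 (S^ι)] -/
theorem smallImageMuTransfer_katoMuTransfer_of_fineZetaContra
    (hF1c : exists_divisibilityInputs_fineQuotient_zeta_contra) :
    Summit.BirchSwinnertonDyer.BirchSwinnertonDyer.Rank1Residual.KatoMuTransfer :=
  smallImageMuTransfer_MuTransfer_of_fineZetaContra hF1c

end Summit.BirchSwinnertonDyer.BirchSwinnertonDyer.Theorems

end
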